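import Summits.CriticalPhenomena.Ising3DConformalLimit.Theses.HyperoctahedralRP
import Summits.CriticalPhenomena.Ising3DConformalLimit.Theses.IsingEuclidUpgrade
import Literature.Probability.LatticeModels.CriticalUrsellFourSign
import Literature.Probability.LatticeModels.BackboneChainRule
import Literature.Probability.LatticeModels.IntersectionSecondMoment
import Literature.Probability.LatticeModels.WeightedCurrentsSwitching

/-!
# Line `partner-backbone-cut` — skeleton for crux `IsingEuclidUpgradeR4NonGaussian`
(item stmt-CriticalPhenomena-0636, shared by the routes HyperoctahedralRP (primary here) /
IsingEuclidUpgrade / IsingCFTData / LinkingParityCircles / …; crux-plan of the idea card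
`Cruxes/IsingEuclidUpgradeR4NonGaussian/Ideas/partner-backbone-cut.md`, triage r1-1/2/3: pass)

The crux (verbatim): every non-degenerate pointwise scaling limit `S` of the renormalised critical
Ising correlators on `ℤ³` (`HasPointwiseScalingLimit (criticalCorr 3) ρ S`, `ρ > 0` on `(0,1]`,
`IsNondegenerateTwoPoint S`) has `HasNontrivialU4 S`. By the Disproof (§B–§C) it is the lower-bound
side of Aizenman's identity `U₄(x,y,z,t) = -2⟨σ_xσ_y⟩⟨σ_zσ_t⟩·P^{xy}⊗P^{zt}[x ↔ z in n₁+n₂]`: the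
double-current intersection probability at scale `1/δ` must stay bounded below.

THE LINE (card, sharpened by the triage panel). Condition on the Aizenman backbone of the partner's
current: let `δ = explore rk n₂ {t} z` be the deterministic exploration of the `{z,t}`-sourced current
(`CurrentExploration.lean`), `D = δ.used` its examined bonds and `γ = δ.vis` its visited sites. By the
chain rule (`tsum_sources_inCyl_eq`) the remainder `m = n₂|_{Dᶜ}` is, conditionally on `δ`, an exact
SOURCELESS current on the cut graph `H_δ = G ∖ D`, independent of `n₁ ~ P^{xy}_G`; for the pair
(`m` on `H_δ` sourceless, `n₁` on `G` sourced) the NESTED switching lemma (ADS 2015 Lemma 2.2 — in the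
tree, PROVED: `Current.etsum_switching_univ`) computes the one-point function of the cluster of `x`
INSIDE `H_δ` in closed form, `P[x ↔ u in H_δ] = ⟨σ_xσ_u⟩_{H_δ}⟨σ_uσ_y⟩_G/⟨σ_xσ_y⟩_G`; every `u ∈ γ`
reached from `x` inside `H_δ` is a CONTACT that forces `x ↔ z` in `n₁ + n₂` (visited sites hang on `z`
through traversed, odd bonds). So with `N_δ = #{u ∈ γ : x ↔ u in H_δ}`:
`P^{xy,zt}[x ↔ z] ≥ Σ_δ π(δ)·P[N_δ ≥ 1 | δ] ≥ Σ_δ π(δ)·E[N_δ|δ]²/E[N_δ²|δ]`, the first moment being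
EXACT. Stubs 1–2 are this finite-volume machinery (provable now); Stub 3 = (R) ROUGHNESS of the
partner's backbone (its helper-assisted `σσ`-capacity seen from `x,y` diverges: `P^{zt}`-probability
`≥ 1/2` above every level `M`, eventually as the mesh `δ → 0`); Stub 4 = (B) SHADOW + second moment
(on `M`-rough backbones the Cauchy–Schwarz ratio with the TRUE conditional second moment averages
`≥ c > 0`) — THE OPEN HEART (card: closes at Wick level iff the backbone cut is an irrelevant
defect, in sharp form iff `D_bb ≥ 2Δ̂_σ(D_bb)`; the cheapest falsifier is the Monte-Carlo shadow
exponent, card §Cheapest falsifier (2)). The composition `hasNontrivialU4_of_stubs` is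
SORRY-FREE: (R)+(B)+Stub 1+Stub 2 ⇒ `2·P_{Λ_L}[x↔z]·Z[xy]Z[zt] ≥ c·Z[xy]Z[zt]` at the lattice points
`[X/δ]` of ONE configuration `X` for `L ≥ L₀(δ)` (`two_mul_connMass_ge`, `real_bound_of_ennreal`) ⇒
`-U₄^{Λ_L} ≥ c⟨σσ⟩⟨σσ⟩` by the PROVED box identity `connectedFour_free_box_eq'` (`negU4_box_ge`) ⇒
`L → ∞` by `tendsto_connectedFour_box_criticalBeta` / `criticalCorr_wellDefined_holds`
(`lattice_bound_of_eventually_box`) ⇒ `δ → 0⁺` along the given limit (`hasNontrivialU4_of_lattice_bound`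
= Disproof §C.1 `of_latticeU4RatioPositive` specialised to the given `S`; uses `IsNondegenerateTwoPoint`).

DISPROOF USED (`Cruxes/IsingEuclidUpgradeR4NonGaussian/Disproof.lean`, cdisprove gen 2):
§A `false_without_nondegeneracy` — honoured: `IsNondegenerateTwoPoint` is used in
`hasNontrivialU4_of_lattice_bound` (sign of `c·S₂S₂ > 0`); `false_without_latticeClause(_moebius)` —
honoured: all four stubs are LATTICE statements about `criticalBeta 3` currents and the limit enters
only through `HasPointwiseScalingLimit` in the last step; `iff_withoutPositivity` — `ρ > 0` is only
fed to the stubs; §B `U4_nonpos`/`abs_U4_le_two_mul` — consistent (we prove `-U₄ ≥ c⟨σσ⟩⟨σσ⟩` with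
`c ≤ 2` automatically); §C — the composition lands exactly on `LatticeU4RatioPositive` at the
configuration `X` of Stub 4 (the weakest lattice estimate proving the crux), and Stubs 3–4 are strictly
more specific (backbone-conditioned contact counts, not the intersection probability); §D
`cruxAt_iff_vacuous_of_five_le` — the `d = 3` input sits in Stubs 3–4 (Stub 3 is FALSE on `ℤ⁵`, where
the helper-assisted contact mean `≍ |γ|·L^{2-d} ≤ L^{4-d} → 0`, and Stub 4 degenerates to vacuity there),
Stubs 1–2 are dimension-free identities/inequalities; no landed `Negative/` lemma exists for this crux
(checked `ledger crux ls`, 2026-08-16). Negatives index (`ledger negatives --problem CriticalPhenomena`,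
2026-08-16): 8 entries (SAW ×4, Cardy ×2, percolation-ℤ³ ×2), none in this sub-problem, none restated.

Registered stubs (4): `stub_backboneCutDecomposition`, `stub_cutContactSecondMoment`,
`stub_partnerBackboneRough`, `stub_backboneShadowBound` (hardest). Composition (sorry-free; axioms
propext / Classical.choice / Quot.sound): `hasNontrivialU4_of_stubs : Stub₁ → Stub₂ → Stub₃ → Stub₄ →
∀ ρ S, … → HasNontrivialU4 S` (the crux unfolded). Skeleton theorems (A12 shape, NO hypotheses, the crux
BY NAME, `sorry` entering only through the four `stub_*`): `IsingEuclidUpgradeR4NonGaussian_of :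
Theses.IsingEuclidUpgrade.IsingEuclidUpgradeR4NonGaussian` (the item's decl) and
`IsingEuclidUpgradeR4NonGaussian_of_hyperoctahedralRP : Theses.HyperoctahedralRP.…` (primary route of the
payload; the IsingCFTData / LinkingParityCircles copies are the same Prop, `Iff.rfl`).
-/

noncomputable section

namespace Summit.CriticalPhenomena.Ising3DConformalLimit.Cruxes.IsingEuclidUpgradeR4NonGaussian.PartnerBackboneCut

open Literature.Probability Literature.Probability.LatticeModels Literature.Probability.Percolation
open MeasureTheory Filter Finset
open scoped Topology symmDiff ENNReal

section FiniteVolume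

variable {V : Type*} [Fintype V] [DecidableEq V] (G : SimpleGraph V) [DecidableRel G.Adj]

/-- **The cut graph** `H_D = G ∖ D`: the graph `G` with the bonds of `D` deleted (same vertex type).
For `D = δ.used`, the examined bonds of the exploration `δ` of the partner's current, this is the graph
on which — conditionally on `δ` — the remainder of that current is an exact sourceless current with the
original couplings (`tsum_sources_inCyl_eq`: couplings `koff K δ.used`). -/
def cutGraph (D : Finset G.edgeFinset) : SimpleGraph V where
  Adj a b := G.Adj a b ∧ s(a, b) ∉ D.image (fun e : G.edgeFinset => (e : Sym2 V))
  symm := ⟨fun a b h => ⟨h.1.symm, by rw [Sym2.eq_swap]; exact h.2⟩⟩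
  loopless := ⟨fun a h => G.loopless.irrefl a h.1⟩

/-- Adjacency in the cut graph. -/
theorem cutGraph_adj {D : Finset G.edgeFinset} {a b : V} :
    (cutGraph G D).Adj a b ↔ G.Adj a b ∧ s(a, b) ∉ D.image (fun e : G.edgeFinset => (e : Sym2 V)) :=
  Iff.rfl

/-- Adjacency in the cut graph is decidable. -/
instance instDecidableRelCutGraphAdj (D : Finset G.edgeFinset) : DecidableRel (cutGraph G D).Adj :=
  fun a b => decidable_of_iff (G.Adj a b ∧ s(a, b) ∉ D.image (fun e : G.edgeFinset => (e : Sym2 V)))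
    (cutGraph_adj G).symm

/-- **Contact count** `N = #{u ∈ S : x ↔ u inside H_D}` of a current `m` (applied to `m + n₁`): the
number of sites of `S` (the backbone `δ.vis`) joined to `x` through bonds of the cut graph carrying
positive current (`Current.connIn (cutGraph G D) x u`). Each contact forces `x ↔ z` in the full trace. -/
def contactCount (D : Finset G.edgeFinset) (S : Finset V) (x : V) (m : Current G) : ℝ≥0∞ :=
  ∑ u ∈ S, (Current.connIn (cutGraph G D) x u).indicator 1 m

variable {G}

/-- **The conditional pair weight given the backbone** (un-normalised law of `(m, n₁)` given `δ`):
`1{m ⊆ E(H_D), ∂m = ∅} w_K(m) · 1{∂n₁ = {x}Δ{y}} w_K(n₁)` — exactly the shape of the left side of the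
tree's nested switching lemma `Current.etsum_switching_univ (cutGraph G D)`. -/
def cutPairWeight (K : G.edgeFinset → ℝ) (D : Finset G.edgeFinset) (x y : V)
    (p : Current G × Current G) : ℝ≥0∞ :=
  (if Current.IsSupp (cutGraph G D) p.1 ∧ p.1.sources = ∅ then p.1.eweight K else 0) *
    (if p.2.sources = {x} ∆ {y} then p.2.eweight K else 0)

/-- **The exact conditional first moment, closed form**: `A = Σ_{u ∈ S} Z_{H_D}[{x}Δ{u}] · Z_G[{y}Δ{u}]`
(`= Σ W·N` by nested switching, Stub 2; normalised: `E[N | δ] = Σ_u ⟨σ_xσ_u⟩_{H_δ}⟨σ_uσ_y⟩_G/⟨σ_xσ_y⟩_G`,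
the cut one-point density of the card; `⟨σ_xσ_u⟩_{H_δ}/⟨σ_xσ_u⟩_G ∈ (0,1]` is the SHADOW factor). -/
def cutFirstMoment (K : G.edgeFinset → ℝ) (D : Finset G.edgeFinset) (S : Finset V) (x y : V) : ℝ≥0∞ :=
  ∑ u ∈ S, ecurrentSumIn (cutGraph G D) K ({x} ∆ {u}) * ecurrentSum K ({y} ∆ {u})

/-- **The helper-assisted (shadow-free) first moment** `A⁺ = Σ_{u ∈ S} Z_G[{x}Δ{u}] · Z_G[{y}Δ{u}]`:
normalised by `Z[xy]Z[∅]` it is `E^{xy,∅}[#(S ∩ C(x))]` on the FULL graph (tree: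
`tsum_epairWeight_mul_indicator_mem_cluster`), the `σσ`-capacity of `S` seen from `x, y`; `A ≤ A⁺` (GKS). -/
def fullFirstMoment (K : G.edgeFinset → ℝ) (S : Finset V) (x y : V) : ℝ≥0∞ :=
  ∑ u ∈ S, ecurrentSum K ({x} ∆ {u}) * ecurrentSum K ({y} ∆ {u})

/-- **The TRUE conditional second moment** (un-normalised) `B = Σ W·N²` — deliberately NOT replaced by a
closed-form upper bound: which factors of its two-switching bound are cut (`H_δ`) two-point functions
is the research content of (B) (card: Wick level `θ = Δ_σ` vs sharp `θ = Δ̂`). -/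
def cutSecondMoment (K : G.edgeFinset → ℝ) (D : Finset G.edgeFinset) (S : Finset V) (x y : V) : ℝ≥0∞ :=
  ∑' p : Current G × Current G, cutPairWeight K D x y p * contactCount G D S x (p.1 + p.2) ^ 2

/-- **The contact mass** `Σ W·1[N ≥ 1]` (un-normalised `P[N_δ ≥ 1 | δ]`). -/
def cutContactMass (K : G.edgeFinset → ℝ) (D : Finset G.edgeFinset) (S : Finset V) (x y : V) : ℝ≥0∞ :=
  ∑' p : Current G × Current G,
    cutPairWeight K D x y p * (if contactCount G D S x (p.1 + p.2) = 0 then 0 else 1)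

/-- **The Cauchy–Schwarz ratio of a backbone state** `A(δ)²/B(δ)` (cut `δ.used`, targets `δ.vis`);
`≤` the contact mass by Stub 2 (`ratio_le_contactMass`). ENNReal conventions `0/0 = 0`, `a/⊤ = 0` are
harmless for a lower bound. -/
def backboneCutRatio (K : G.edgeFinset → ℝ) (x y : V) (δ : Current.XState G) : ℝ≥0∞ :=
  cutFirstMoment K δ.used δ.vis x y ^ 2 / cutSecondMoment K δ.used δ.vis x y

/-- **`M`-rough backbone states**: final states `δ` of the exploration of the `{z,t}`-current from `z`
(tree `Current.finalStates rk {t} z t`) whose helper-assisted contact mean from `x, y` is at least `M`: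
`A⁺(δ) ≥ M · Z[xy] · Z[∅]`, i.e. `E^{xy,∅}[#(δ.vis ∩ C(x))] ≥ M`. -/
def roughStates (K : G.edgeFinset → ℝ) (rk : G.edgeFinset → ℕ) (M : ℝ) (x y z t : V) :
    Finset (Current.XState G) :=
  (Current.finalStates rk {t} z t).filter fun δ =>
    ENNReal.ofReal M * (ecurrentSum K ({x} ∆ {y}) * ecurrentSum K ∅) ≤ fullFirstMoment K δ.vis x y

/-- **Mass of the `M`-rough backbones**: `Σ_{δ rough} patSum(δ)·Z_{K off δ.used}[∅]`; divided by `Z[zt]`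
(`= Σ_{all δ} patSum·Z_off[∅]`, chain rule) this is `P^{zt}[the backbone is M-rough]`. -/
def roughMass (K : G.edgeFinset → ℝ) (rk : G.edgeFinset → ℕ) (M : ℝ) (x y z t : V) : ℝ≥0∞ :=
  ∑ δ ∈ roughStates K rk M x y z t, patSum K δ * ecurrentSum (koff K δ.used) ∅

/-- **The Cauchy–Schwarz ratio integrated over `M`-rough backbones**: `Σ_{δ rough} patSum(δ)·A(δ)²/B(δ)`. -/
def roughRatioMass (K : G.edgeFinset → ℝ) (rk : G.edgeFinset → ℕ) (M : ℝ) (x y z t : V) : ℝ≥0∞ :=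
  ∑ δ ∈ roughStates K rk M x y z t, patSum K δ * backboneCutRatio K x y δ

variable (G) in
/-- **The connection mass** `P^{{x}Δ{y},{z}Δ{t}}_{G,β}[x ↔ z in n₁+n₂] · Z[{x}Δ{y}] · Z[{z}Δ{t}]`
(`= Σ 1{∂n₁={x}Δ{y}}1{∂n₂={z}Δ{t}} w w 1[x ↔ z]` by `doubleCurrentMeasure_real_mul'`), uniform
coupling `β`: the quantity `-U₄ · Z[∅]²/2` of the box identity `connectedFour_free_box_eq'`. -/
def connMass (β : ℝ) (x y z t : V) : ℝ≥0∞ :=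
  ENNReal.ofReal ((doubleCurrentMeasure G β ({x} ∆ {y}) ({z} ∆ {t})).real (tracedConn G x z) *
    (currentSum G β ({x} ∆ {y}) * currentSum G β ({z} ∆ {t})))

end FiniteVolume

/-- **Stub 1 statement — backbone-cut decomposition + contact inclusion** (finite graph, uniform
`β ≥ 0`, any injective ranking): `Σ_{δ ∈ finalStates(z→t)} patSum(δ) · (Σ W_δ 1[N_δ ≥ 1]) ≤ P[x↔z]·Z[xy]Z[zt]`.
Mechanism: partition the `{z,t}`-currents `n₂` by their exploration `δ = explore rk n₂ {t} z` (ends at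
`t`, `explore_done_of_sources_eq`; partition `tsum_mul_indicator_pos_eq_sum`); on `Cyl(δ)` write
`n₂ = pattern part + m`, weights multiply, the pattern parts sum to `patSum δ` and `m` ranges over the
sourceless currents supported off `δ.used` (`tsum_sources_inCyl_eq` with a functional of the off-part,
`tsum_eq_tsum_prod_onEdges`, `sources_eq_of_cls_eq`); and `{N_δ(m+n₁) ≥ 1} ⊆ {x ↔ z in n₁+n₂}`
(a cut-graph path avoids `δ.used`, where `n₂ = m`; visited sites hang on `z` by traversed odd bonds:
`vis_subset_tch_explore`, `tch_explore_subset_cluster`). Equality holds before the inclusion. -/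
def BackboneCutDecomposition : Prop :=
  ∀ (V : Type) [Fintype V] [DecidableEq V] (G : SimpleGraph V) [DecidableRel G.Adj]
    (β : ℝ), 0 ≤ β → ∀ (rk : G.edgeFinset → ℕ), Function.Injective rk → ∀ (x y z t : V),
      ∑ δ ∈ Current.finalStates rk {t} z t,
          patSum (fun _ => β) δ * cutContactMass (fun _ => β) δ.used δ.vis x y
        ≤ connMass G β x y z t

/-- **Stub 2 statement — the cut one-point function is exact ⇒ second-moment lower bound for
contact** (finite graph, couplings `K ≥ 0`, any cut `D`, any target set `S`): `A² ≤ (Σ W 1[N≥1])·(Σ W N²)`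
with `A = cutFirstMoment` the CLOSED FORM. Mechanism: `Σ W N = Σ_{u∈S} Σ W 1[x ↔ u in H_D] = A` by the
nested switching lemma `Current.etsum_switching_univ (cutGraph G D) hK ∅ ({x}Δ{y}) x u 1` (the switched
side carries its indicator automatically, `add_mem_connIn_of_sources_eq`; `({x}Δ{y}) Δ ({x}Δ{u}) = {y}Δ{u}`;
`ecurrentSumIn_mul_ecurrentSum`), then Cauchy–Schwarz `tsum_mul_sq_le_tsum_indicator_mul_tsum_sq`.
ADS 2015 Lemma 2.2 / ADC 2021 App. A pattern; triage r1-2/r1-3 certified the identity numerically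
(relerr 3e-15). -/
def CutContactSecondMoment : Prop :=
  ∀ (V : Type) [Fintype V] [DecidableEq V] (G : SimpleGraph V) [DecidableRel G.Adj]
    (K : G.edgeFinset → ℝ), (∀ e, 0 ≤ K e) → ∀ (D : Finset G.edgeFinset) (S : Finset V) (x y : V),
      cutFirstMoment K D S x y ^ 2 ≤ cutContactMass K D S x y * cutSecondMoment K D S x y

/-! ### L1–L2: the abstract assembly (finite graph) -/

section Assembly

variable {V : Type} [Fintype V] [DecidableEq V] {G : SimpleGraph V} [DecidableRel G.Adj]

/-- Stub 2 ⇒ `A(δ)²/B(δ) ≤` contact mass. -/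
theorem ratio_le_contactMass (h2 : CutContactSecondMoment) {K : G.edgeFinset → ℝ} (hK : ∀ e, 0 ≤ K e)
    (x y : V) (δ : Current.XState G) :
    backboneCutRatio K x y δ ≤ cutContactMass K δ.used δ.vis x y := by
  unfold backboneCutRatio
  exact ENNReal.div_le_of_le_mul (h2 V G K hK δ.used δ.vis x y)

/-- **L1 — the abstract assembly** (finite graph, uniform `β`): Stub 1 + Stub 2 + the (R)-inequality
`Z[zt] ≤ 2·roughMass` + the (B)-inequality `c·roughMass·Z[xy] ≤ roughRatioMass` give
`c · Z[zt] · Z[xy] ≤ 2 · P[x↔z]·Z[xy]Z[zt]`. -/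
theorem two_mul_connMass_ge (h1 : BackboneCutDecomposition) (h2 : CutContactSecondMoment)
    {β : ℝ} (hβ : 0 ≤ β) {rk : G.edgeFinset → ℕ} (hrk : Function.Injective rk) (x y z t : V)
    {M c : ℝ}
    (hR : ecurrentSum (fun _ : G.edgeFinset => β) ({z} ∆ {t}) ≤ 2 * roughMass (fun _ => β) rk M x y z t)
    (hB : ENNReal.ofReal c * (roughMass (fun _ : G.edgeFinset => β) rk M x y z t *
        ecurrentSum (fun _ : G.edgeFinset => β) ({x} ∆ {y})) ≤ roughRatioMass (fun _ => β) rk M x y z t) :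
    ENNReal.ofReal c * (ecurrentSum (fun _ : G.edgeFinset => β) ({z} ∆ {t}) *
        ecurrentSum (fun _ : G.edgeFinset => β) ({x} ∆ {y})) ≤ 2 * connMass G β x y z t := by
  have hK : ∀ e : G.edgeFinset, 0 ≤ (fun _ : G.edgeFinset => β) e := fun _ => hβ
  -- roughRatioMass ≤ full sum of patSum * contactMass ≤ connMass
  have hRR : roughRatioMass (fun _ : G.edgeFinset => β) rk M x y z t ≤ connMass G β x y z t := by
    refine le_trans ?_ (h1 V G β hβ rk hrk x y z t)
    unfold roughRatioMass roughStates
    refine le_trans (Finset.sum_le_sum_of_subset (Finset.filter_subset _ _)) ?_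
    exact Finset.sum_le_sum fun δ _ => mul_le_mul' le_rfl (ratio_le_contactMass h2 hK x y δ)
  calc ENNReal.ofReal c * (ecurrentSum (fun _ : G.edgeFinset => β) ({z} ∆ {t}) *
          ecurrentSum (fun _ : G.edgeFinset => β) ({x} ∆ {y}))
      ≤ ENNReal.ofReal c * ((2 * roughMass (fun _ => β) rk M x y z t) *
          ecurrentSum (fun _ : G.edgeFinset => β) ({x} ∆ {y})) :=
        mul_le_mul' le_rfl (mul_le_mul' hR le_rfl)
    _ = 2 * (ENNReal.ofReal c * (roughMass (fun _ : G.edgeFinset => β) rk M x y z t *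
          ecurrentSum (fun _ : G.edgeFinset => β) ({x} ∆ {y}))) := by ring
    _ ≤ 2 * roughRatioMass (fun _ => β) rk M x y z t := mul_le_mul' le_rfl hB
    _ ≤ 2 * connMass G β x y z t := mul_le_mul' le_rfl hRR

/-- **L2 — back to real numbers**: `c · Z[xy]Z[zt] ≤ 2 · P^{xy,zt}[x↔z] · Z[xy]Z[zt]`
(`ecurrentSum_eq_ofReal`, `currentSum_eq_wcurrentSum`). -/
theorem real_bound_of_ennreal {β : ℝ} (hβ : 0 ≤ β) (x y z t : V) {c : ℝ} (hc : 0 ≤ c)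
    (h : ENNReal.ofReal c * (ecurrentSum (fun _ : G.edgeFinset => β) ({z} ∆ {t}) *
        ecurrentSum (fun _ : G.edgeFinset => β) ({x} ∆ {y})) ≤ 2 * connMass G β x y z t) :
    c * (currentSum G β ({x} ∆ {y}) * currentSum G β ({z} ∆ {t})) ≤
      2 * ((doubleCurrentMeasure G β ({x} ∆ {y}) ({z} ∆ {t})).real (tracedConn G x z) *
        (currentSum G β ({x} ∆ {y}) * currentSum G β ({z} ∆ {t}))) := by
  have hK : ∀ e : G.edgeFinset, 0 ≤ (fun _ : G.edgeFinset => β) e := fun _ => hβ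
  have hZ : ∀ A : Finset V, ecurrentSum (fun _ : G.edgeFinset => β) A = ENNReal.ofReal (currentSum G β A) := by
    intro A
    rw [ecurrentSum_eq_ofReal hK, ← currentSum_eq_wcurrentSum]
  have hxy0 : 0 ≤ currentSum G β ({x} ∆ {y}) := currentSum_nonneg G hβ _
  have hzt0 : 0 ≤ currentSum G β ({z} ∆ {t}) := currentSum_nonneg G hβ _
  have hP0 : 0 ≤ (doubleCurrentMeasure G β ({x} ∆ {y}) ({z} ∆ {t})).real (tracedConn G x z) :=
    measureReal_nonneg
  rw [hZ, hZ, ← ENNReal.ofReal_mul hzt0, ← ENNReal.ofReal_mul hc] at h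
  unfold connMass at h
  rw [← ENNReal.ofReal_ofNat 2, ← ENNReal.ofReal_mul (by norm_num : (0:ℝ) ≤ 2)] at h
  have h' := (ENNReal.ofReal_le_ofReal_iff (by positivity)).1 h
  nlinarith [h']

end Assembly


/-! ### Lattice side: points of a configuration inside the box graphs -/

/-- A site of `ℤ³` read in the vertex type `BoxVertex 3 L = ↥Λ_{L+1}` (junk: the origin, when
`v ∉ Λ_{L+1}`). -/
def boxPt (L : ℕ) (v : Site 3) : BoxVertex 3 L :=
  if h : v ∈ LatticeModels.box 3 (L + 1) then ⟨v, h⟩ else ⟨0, LatticeModels.zero_mem_box 3 (L + 1)⟩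

/-- `boxPt` is the inclusion on `Λ_{L+1}`. -/
theorem coe_boxPt {L : ℕ} {v : Site 3} (h : v ∈ LatticeModels.box 3 (L + 1)) :
    (boxPt L v : Site 3) = v := by
  unfold boxPt; rw [dif_pos h]

/-- The lattice points `[X_i/δ]` of a configuration `X`, in the box vertex type. -/
def meshPt (L : ℕ) (δ : ℝ) (X : Fin 4 → EuclideanSpace ℝ (Fin 3)) (i : Fin 4) : BoxVertex 3 L :=
  boxPt L (latticeApprox δ (X i))

/-- Eventually the four lattice points lie in `Λ_L`. -/
theorem eventually_forall_latticeApprox_mem_box (δ : ℝ) (X : Fin 4 → EuclideanSpace ℝ (Fin 3)) :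
    ∀ᶠ L : ℕ in atTop, ∀ i, latticeApprox δ (X i) ∈ LatticeModels.box 3 L := by
  classical
  obtain ⟨L₀, hL₀⟩ := exists_forall_subset_box 3 (Finset.univ.image fun i => latticeApprox δ (X i))
  filter_upwards [eventually_ge_atTop L₀] with L hL i
  exact hL₀ L hL (Finset.mem_image_of_mem _ (Finset.mem_univ i))

/-! ### Stub 3 and Stub 4 statements (the open heart, on `ℤ³` at `β_c`) -/

/-- **Stub 3 statement — (R) ROUGHNESS of the partner's backbone** (`ℤ³`, `β_c`, under the crux's own
hypotheses): for every non-coincident configuration `X`, every level `M`, eventually as the mesh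
`δ → 0⁺` and then the box `Λ_L ↑ ℤ³`, for every injective ranking, the explored backbone of the
`{[X₂/δ],[X₃/δ]}`-current is `M`-rough with `P^{zt}`-probability `≥ 1/2`:
`Z[zt] ≤ 2 · roughMass` (`Z[zt] = Σ_{all δ} patSum·Z_off[∅]`). In words: the helper-assisted contact
mean `Σ_{u ∈ vis δ} ⟨σ_xσ_u⟩⟨σ_uσ_y⟩/⟨σ_xσ_y⟩ ≍ |vis δ ∩ bulk|·G(1/δ)` diverges in probability —
backbone `σσ`-capacity dimension `> 2Δ_σ = 1+η` (numerics: `D_HT = 1.7349(65)` vs `1+η = 1.036`;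
rigorously open: Aizenman–Burchard 1999 regularity + two-point bounds; under the limit hypotheses `G` is
regularly varying of index `-2Δ`, `Δ ∈ [1/2,3/4]`, so the worst case needs `D_bb > 3/2`). -/
def PartnerBackboneRough : Prop :=
  ∀ (ρ : ℝ → ℝ) (S : CorrFamily 3), (∀ δ ∈ Set.Ioc (0:ℝ) 1, 0 < ρ δ) →
    HasPointwiseScalingLimit (criticalCorr 3) ρ S → IsNondegenerateTwoPoint S →
    ∀ X ∈ NonCoincident 3 4, ∀ M : ℝ,
      ∀ᶠ δ in 𝓝[>] (0:ℝ), ∀ᶠ L : ℕ in atTop,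
        ∀ rk : (freeBoxGraph 3 L).edgeFinset → ℕ, Function.Injective rk →
          ecurrentSum (fun _ : (freeBoxGraph 3 L).edgeFinset => criticalBeta 3)
              ({meshPt L δ X 2} ∆ {meshPt L δ X 3})
            ≤ 2 * roughMass (fun _ : (freeBoxGraph 3 L).edgeFinset => criticalBeta 3) rk M
                (meshPt L δ X 0) (meshPt L δ X 1) (meshPt L δ X 2) (meshPt L δ X 3)

/-- **Stub 4 statement — (B) SHADOW + SECOND MOMENT, the open heart** (`ℤ³`, `β_c`, under the crux's
hypotheses): for SOME non-coincident configuration `X` (e.g. the pinched one of the card's amplified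
variant), some roughness level `M` and some `c > 0`, eventually (`δ → 0⁺`, then `L → ∞`), for every
injective ranking, the Cauchy–Schwarz contact ratio integrated over the `M`-rough backbones is at least
`c` times their mass: `c · roughMass · Z[xy] ≤ Σ_{δ rough} patSum(δ)·A(δ)²/B(δ)` — i.e. on rough
backbones `P[N_δ ≥ 1 | δ] ≥ E[N|δ]²/E[N²|δ] ≳ c` on average. Content: (B1) no total shadowing — the cut
first moment `A(δ)` stays comparable to its target on rough backbones (card: `a = D - Δ_σ - Δ̂ ≥ 0`, FORCED
by the crux through the exact necessary condition `P[x↔z|δ] ≤ E Ñ_δ`); (B2) burstiness — the true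
second moment is `≲ A²/ν`. Card ledger: closes at Wick level iff the cut is irrelevant (`D_bb < Δ_ε =
1.41`, predicted false), in sharp form iff `D_bb ≥ 2Δ̂_σ(D_bb)` (interpolation `2Δ̂ ≈ 1.86` vs `1.73`:
undecided → falsifier (2) of the card decides). `M` is at the prover's disposal (Stub 3 makes every
level typical); a vacuous discharge (no `M`-rough backbones at `X`) would refute Stub 3 at `X`. -/
def BackboneShadowBound : Prop :=
  ∀ (ρ : ℝ → ℝ) (S : CorrFamily 3), (∀ δ ∈ Set.Ioc (0:ℝ) 1, 0 < ρ δ) →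
    HasPointwiseScalingLimit (criticalCorr 3) ρ S → IsNondegenerateTwoPoint S →
    ∃ X ∈ NonCoincident 3 4, ∃ M : ℝ, ∃ c : ℝ, 0 < c ∧
      ∀ᶠ δ in 𝓝[>] (0:ℝ), ∀ᶠ L : ℕ in atTop,
        ∀ rk : (freeBoxGraph 3 L).edgeFinset → ℕ, Function.Injective rk →
          ENNReal.ofReal c *
              (roughMass (fun _ : (freeBoxGraph 3 L).edgeFinset => criticalBeta 3) rk M
                  (meshPt L δ X 0) (meshPt L δ X 1) (meshPt L δ X 2) (meshPt L δ X 3) *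
                ecurrentSum (fun _ : (freeBoxGraph 3 L).edgeFinset => criticalBeta 3)
                  ({meshPt L δ X 0} ∆ {meshPt L δ X 1}))
            ≤ roughRatioMass (fun _ : (freeBoxGraph 3 L).edgeFinset => criticalBeta 3) rk M
                (meshPt L δ X 0) (meshPt L δ X 1) (meshPt L δ X 2) (meshPt L δ X 3)

/-! ### L3: from the current bound to `-U₄ ≥ c ⟨σσ⟩⟨σσ⟩` in the box -/

/-- The box trace law of `{x ↔ z}` is the double-current measure of `tracedConn`
(`sourcedDoubleCurrentLaw_apply`, `boxSources_pair`, `sourcedTrace_preimage_openConn`). -/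
theorem sourcedDoubleCurrentLaw_real_openConn_eq {L : ℕ} (β : ℝ) (x y z t : BoxVertex 3 L) :
    (sourcedDoubleCurrentLaw 3 L β ({(x : Site 3)} ∆ {(y : Site 3)}) ({(z : Site 3)} ∆ {(t : Site 3)})).real
        (openConn (x : Site 3) (z : Site 3)) =
      (doubleCurrentMeasure (freeBoxGraph 3 L) β ({x} ∆ {y}) ({z} ∆ {t})).real
        (tracedConn (freeBoxGraph 3 L) x z) := by
  rw [measureReal_def, measureReal_def,
    sourcedDoubleCurrentLaw_apply L β _ _ (measurableSet_openConn_holds (x : Site 3) (z : Site 3)),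
    boxSources_pair, boxSources_pair, sourcedTrace_preimage_openConn]

/-- **L3 — the box identity**: from `c·Z[xy]Z[zt] ≤ 2P·Z[xy]Z[zt]` on the free box graph to
`c·⟨σ_xσ_y⟩_{Λ_L}⟨σ_zσ_t⟩_{Λ_L} ≤ -U₄^{Λ_L}(x,y,z,t)` (PROVED random-current identity
`connectedFour_free_box_eq'`, `⟨σ_aσ_b⟩ = Z[ab]/Z[∅]` by `isingTwoPoint_free_eq_currentSum_div_holds`). -/
theorem negU4_box_ge {L : ℕ} {β : ℝ} (hβ : 0 ≤ β) (x y z t : BoxVertex 3 L)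
    (hx : (x : Site 3) ∈ LatticeModels.box 3 L) (hy : (y : Site 3) ∈ LatticeModels.box 3 L)
    (hz : (z : Site 3) ∈ LatticeModels.box 3 L) (ht : (t : Site 3) ∈ LatticeModels.box 3 L) {c : ℝ}
    (h : c * (currentSum (freeBoxGraph 3 L) β ({x} ∆ {y}) * currentSum (freeBoxGraph 3 L) β ({z} ∆ {t})) ≤
      2 * ((doubleCurrentMeasure (freeBoxGraph 3 L) β ({x} ∆ {y}) ({z} ∆ {t})).real
        (tracedConn (freeBoxGraph 3 L) x z) *
        (currentSum (freeBoxGraph 3 L) β ({x} ∆ {y}) * currentSum (freeBoxGraph 3 L) β ({z} ∆ {t})))) :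
    c * (isingTwoPoint (zdGraph 3) (LatticeModels.box 3 L) β 0 .free x y *
        isingTwoPoint (zdGraph 3) (LatticeModels.box 3 L) β 0 .free z t) ≤
      - connectedFour (isingMeasure (zdGraph 3) (LatticeModels.box 3 L) β 0 .free) spinAt
          ![(x : Site 3), (y : Site 3), (z : Site 3), (t : Site 3)] := by
  rw [connectedFour_free_box_eq' 3 L hβ x y z t hx hy hz ht, sourcedDoubleCurrentLaw_real_openConn_eq,
    isingTwoPoint_free_box_eq_boxGraph 3 L β x y hx hy, isingTwoPoint_free_box_eq_boxGraph 3 L β z t hz ht,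
    isingTwoPoint_free_eq_currentSum_div_holds, isingTwoPoint_free_eq_currentSum_div_holds]
  set Zxy := currentSum (freeBoxGraph 3 L) β ({x} ∆ {y})
  set Zzt := currentSum (freeBoxGraph 3 L) β ({z} ∆ {t})
  set Z0 := currentSum (freeBoxGraph 3 L) β ∅
  set P := (doubleCurrentMeasure (freeBoxGraph 3 L) β ({x} ∆ {y}) ({z} ∆ {t})).real
        (tracedConn (freeBoxGraph 3 L) x z)
  have hZ0 : 0 < Z0 := currentSum_empty_pos' _ β
  have key := div_le_div_of_nonneg_right h (le_of_lt (pow_pos hZ0 2))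
  calc c * (Zxy / Z0 * (Zzt / Z0)) = c * (Zxy * Zzt) / Z0 ^ 2 := by
        field_simp
    _ ≤ 2 * (P * (Zxy * Zzt)) / Z0 ^ 2 := key
    _ = -(-2 * (Zxy / Z0) * (Zzt / Z0) * P) := by
        field_simp

/-! ### L4: the box limit `L → ∞` at `β_c` -/

/-- **L4 — `Λ_L ↑ ℤ³` at `β_c`**: the box inequality passes to the critical state
(`tendsto_connectedFour_box_criticalBeta`, `criticalCorr_wellDefined_holds`). -/
theorem lattice_bound_of_eventually_box (pts : Fin 4 → Site 3) {c : ℝ}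
    (h : ∀ᶠ L : ℕ in atTop,
      c * (isingTwoPoint (zdGraph 3) (LatticeModels.box 3 L) (criticalBeta 3) 0 .free (pts 0) (pts 1) *
          isingTwoPoint (zdGraph 3) (LatticeModels.box 3 L) (criticalBeta 3) 0 .free (pts 2) (pts 3)) ≤
        - connectedFour (isingMeasure (zdGraph 3) (LatticeModels.box 3 L) (criticalBeta 3) 0 .free)
            spinAt pts) :
    c * (criticalCorr 3 2 ![pts 0, pts 1] * criticalCorr 3 2 ![pts 2, pts 3]) ≤
      -(criticalCorr 3 4 pts - (criticalCorr 3 2 ![pts 0, pts 1] * criticalCorr 3 2 ![pts 2, pts 3]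
        + criticalCorr 3 2 ![pts 0, pts 2] * criticalCorr 3 2 ![pts 1, pts 3]
        + criticalCorr 3 2 ![pts 0, pts 3] * criticalCorr 3 2 ![pts 1, pts 2])) := by
  classical
  have hd : 3 ≤ 3 := le_rfl
  have hmem : (BoundaryCondition.free : BoundaryCondition (Site 3)) ∈
      ({.free, .plus, .minus} : Set (BoundaryCondition (Site 3))) := by simp
  have hT : ∀ i j : Fin 4, Tendsto (fun L : ℕ => isingTwoPoint (zdGraph 3) (LatticeModels.box 3 L)
      (criticalBeta 3) 0 .free (pts i) (pts j)) atTop (𝓝 (criticalCorr 3 2 ![pts i, pts j])) := by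
    intro i j
    have h2 := criticalCorr_wellDefined_holds (d := 3) hd 2 ![pts i, pts j] .free hmem
    refine Tendsto.congr (fun L => ?_) h2
    simp only [isingTwoPoint, spinMonomial_two]
  exact le_of_tendsto_of_tendsto (((hT 0 1).mul (hT 2 3)).const_mul c)
    (tendsto_connectedFour_box_criticalBeta hd pts).neg h

/-! ### L5: the scaling limit `δ → 0⁺` (Disproof §C.1 `of_latticeU4RatioPositive`, for a given
limit `S`) -/

/-- **L5 — `δ → 0⁺` along the given limit** (Disproof §C.1 `of_latticeU4RatioPositive`, re-proved for a
given `(ρ, S)`; this is where `IsNondegenerateTwoPoint` is used): an eventual lattice bound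
`c·⟨σσ⟩⟨σσ⟩([X/δ]) ≤ -U₄^{lat}([X/δ])` with `c > 0` gives `U₄^S(X) < 0`. -/
theorem hasNontrivialU4_of_lattice_bound {ρ : ℝ → ℝ} {S : CorrFamily 3}
    (hlim : HasPointwiseScalingLimit (criticalCorr 3) ρ S) (hnd : IsNondegenerateTwoPoint S)
    {X : Fin 4 → EuclideanSpace ℝ (Fin 3)} (hX : X ∈ NonCoincident 3 4) {c : ℝ} (hc : 0 < c)
    (hev : ∀ᶠ δ in 𝓝[>] (0:ℝ),
      c * (criticalCorr 3 2 ![latticeApprox δ (X 0), latticeApprox δ (X 1)] *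
          criticalCorr 3 2 ![latticeApprox δ (X 2), latticeApprox δ (X 3)]) ≤
        -(criticalCorr 3 4 (fun i => latticeApprox δ (X i)) -
          (criticalCorr 3 2 ![latticeApprox δ (X 0), latticeApprox δ (X 1)] *
              criticalCorr 3 2 ![latticeApprox δ (X 2), latticeApprox δ (X 3)]
            + criticalCorr 3 2 ![latticeApprox δ (X 0), latticeApprox δ (X 2)] *
              criticalCorr 3 2 ![latticeApprox δ (X 1), latticeApprox δ (X 3)]
            + criticalCorr 3 2 ![latticeApprox δ (X 0), latticeApprox δ (X 3)] *
              criticalCorr 3 2 ![latticeApprox δ (X 1), latticeApprox δ (X 2)]))) :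
    HasNontrivialU4 S := by
  have hinj : Function.Injective X := hX
  have hpair : ∀ i j, i ≠ j → Tendsto
      (fun δ => ρ δ ^ 2 * criticalCorr 3 2 ![latticeApprox δ (X i), latticeApprox δ (X j)])
      (𝓝[>] 0) (𝓝 (S 2 ![X i, X j])) := by
    intro i j hij
    have hmem : (![X i, X j] : Fin 2 → EuclideanSpace ℝ (Fin 3)) ∈ NonCoincident 3 2 :=
      pair_mem_nonCoincident fun h => hij (hinj h)
    refine Tendsto.congr (fun δ => ?_) ((hlim 2).tendsto_at hmem)
    rw [rescaledCorrelator_apply, latticeApprox_comp_two]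
    rfl
  have hU := tendsto_rescaled_criticalUrsellFour hlim hX
  have hB := (((hpair 0 1 (by decide)).mul (hpair 2 3 (by decide))).const_mul c)
  have hle : c * (S 2 ![X 0, X 1] * S 2 ![X 2, X 3]) ≤ - limitConnectedFour S X := by
    refine le_of_tendsto_of_tendsto hB hU.neg ?_
    filter_upwards [hev] with δ hδ
    have h4 : (0:ℝ) ≤ ρ δ ^ 4 := by positivity
    have := mul_le_mul_of_nonneg_left hδ h4
    calc c * (ρ δ ^ 2 * criticalCorr 3 2 ![latticeApprox δ (X 0), latticeApprox δ (X 1)] *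
          (ρ δ ^ 2 * criticalCorr 3 2 ![latticeApprox δ (X 2), latticeApprox δ (X 3)]))
        = ρ δ ^ 4 * (c * (criticalCorr 3 2 ![latticeApprox δ (X 0), latticeApprox δ (X 1)] *
          criticalCorr 3 2 ![latticeApprox δ (X 2), latticeApprox δ (X 3)])) := by ring
      _ ≤ _ := this
      _ = _ := by ring
  have h01 : (![X 0, X 1] : Fin 2 → _) ∈ NonCoincident 3 2 :=
    pair_mem_nonCoincident fun h => absurd (hinj h) (by decide)
  have h23 : (![X 2, X 3] : Fin 2 → _) ∈ NonCoincident 3 2 :=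
    pair_mem_nonCoincident fun h => absurd (hinj h) (by decide)
  have hpos : 0 < c * (S 2 ![X 0, X 1] * S 2 ![X 2, X 3]) :=
    mul_pos hc (mul_pos (hnd _ h01) (hnd _ h23))
  exact ⟨X, hX, by linarith⟩

/-! ### The composition -/

/-- A canonical injective ranking of the bonds of the free box graph (Stubs 3–4 hold for every
injective ranking; the composition uses this one). -/
def canonicalRanking (L : ℕ) : (freeBoxGraph 3 L).edgeFinset → ℕ :=
  fun e => (Fintype.equivFin ((freeBoxGraph 3 L).edgeFinset) e : ℕ)

/-- The canonical ranking is injective. -/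
theorem canonicalRanking_injective (L : ℕ) : Function.Injective (canonicalRanking L) :=
  fun _ _ h => (Fintype.equivFin _).injective (Fin.ext h)

/-- **THE COMPOSITION (sorry-free)** `hasNontrivialU4_of_stubs` — the four stub STATEMENTS, taken as
hypotheses, imply the crux in its unfolded form (the route decls `Theses.<Route>.IsingEuclidUpgradeR4NonGaussian`
are this Prop by `Iff.rfl`, Disproof `crux_iff`). Per limit `(ρ,S)`: Stub 4 gives `X, M, c`; Stub 3 at
`(X, M)`; for `δ` in both eventualities and `L` with the four lattice points in `Λ_L`, instantiate Stubs
1–2 on `freeBoxGraph 3 L` at the canonical ranking and chain L1 → L2 → L3; then L4 (`L → ∞`) and L5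
(`δ → 0⁺`). Axioms: propext, Classical.choice, Quot.sound. -/
theorem hasNontrivialU4_of_stubs
    (h1 : BackboneCutDecomposition) (h2 : CutContactSecondMoment)
    (h3 : PartnerBackboneRough) (h4 : BackboneShadowBound) :
    ∀ (ρ : ℝ → ℝ) (S : CorrFamily 3), (∀ δ ∈ Set.Ioc (0:ℝ) 1, 0 < ρ δ) →
      HasPointwiseScalingLimit (criticalCorr 3) ρ S → IsNondegenerateTwoPoint S → HasNontrivialU4 S := by
  intro ρ S hρ hlim hnd
  obtain ⟨X, hX, M, c, hc, hB⟩ := h4 ρ S hρ hlim hnd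
  have hR := h3 ρ S hρ hlim hnd X hX M
  refine hasNontrivialU4_of_lattice_bound hlim hnd hX hc ?_
  filter_upwards [hR, hB] with δ hRδ hBδ
  have key := lattice_bound_of_eventually_box (fun i => latticeApprox δ (X i)) (c := c) ?_
  · simpa using key
  filter_upwards [hRδ, hBδ, eventually_forall_latticeApprox_mem_box δ X] with L hRL hBL hmem
  have hmem' : ∀ i, latticeApprox δ (X i) ∈ LatticeModels.box 3 (L + 1) :=
    fun i => box_subset_box_succ 3 L (hmem i)
  have hcoe : ∀ i, (meshPt L δ X i : Site 3) = latticeApprox δ (X i) := fun i => coe_boxPt (hmem' i)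
  have hE := two_mul_connMass_ge h1 h2 (criticalBeta_nonneg 3) (canonicalRanking_injective L)
    (meshPt L δ X 0) (meshPt L δ X 1) (meshPt L δ X 2) (meshPt L δ X 3)
    (hRL _ (canonicalRanking_injective L)) (hBL _ (canonicalRanking_injective L))
  have hreal := real_bound_of_ennreal (criticalBeta_nonneg 3) (meshPt L δ X 0) (meshPt L δ X 1)
    (meshPt L δ X 2) (meshPt L δ X 3) hc.le hE
  have hbox := negU4_box_ge (criticalBeta_nonneg 3) (meshPt L δ X 0) (meshPt L δ X 1)
    (meshPt L δ X 2) (meshPt L δ X 3) (by rw [hcoe]; exact hmem 0) (by rw [hcoe]; exact hmem 1)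
    (by rw [hcoe]; exact hmem 2) (by rw [hcoe]; exact hmem 3) hreal
  have hvec : (![latticeApprox δ (X 0), latticeApprox δ (X 1), latticeApprox δ (X 2),
      latticeApprox δ (X 3)] : Fin 4 → Site 3) = fun i => latticeApprox δ (X i) := by
    funext i; fin_cases i <;> rfl
  rw [hcoe, hcoe, hcoe, hcoe, hvec] at hbox
  exact hbox


/-! ### Registered stubs (the lemmas of the line; `sorry` only here) -/

/-- **Stub 1 — backbone-cut decomposition + contact inclusion** (see `BackboneCutDecomposition`).
Plausibly true: it is an identity-plus-inclusion whose every ingredient is a tree theorem (chain rule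
`tsum_sources_inCyl_eq` / `tsum_inCyl_of_mem_finalStates`, partition `tsum_mul_indicator_pos_eq_sum`,
`explore_done_of_sources_eq`, `vis_subset_tch_explore`, `tch_explore_subset_cluster`,
`doubleCurrentMeasure_real_mul'`); the new work is the functional version of the chain rule (the
remainder enters through `1[N ≥ 1]`, not only through its total weight) and the `ℝ≥0∞`/real
bookkeeping of `connMass`. Size M. Dimension-free (no `d = 3` input). -/
theorem stub_backboneCutDecomposition : BackboneCutDecomposition := by
  sorry

/-- **Stub 2 — exact cut first moment + Cauchy–Schwarz** (see `CutContactSecondMoment`). Plausibly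
true: ADS 2015 Lemma 2.2 is PROVED in the tree in exactly the needed nested form
(`Current.etsum_switching_univ`, first current supported on a subgraph, connection read inside it), and
the CS step is `Current.tsum_mul_sq_le_tsum_indicator_mul_tsum_sq`. Size S–M (Fubini over `u ∈ S`,
dropping the automatic indicator, symmetric-difference algebra). Dimension-free. -/
theorem stub_cutContactSecondMoment : CutContactSecondMoment := by
  sorry

/-- **Stub 3 — (R) roughness of the partner's backbone** (see `PartnerBackboneRough`). Plausibly true:
critical high-temperature graphs / current backbones on `ℤ³` have fractal dimension `D ≈ 1.73`
(Winter–Janke–Schakel 2008) far above `1+η ≈ 1.04`, and the statement only asks for DIVERGENCE of the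
`σσ`-capacity in probability; rigorous route: Aizenman–Burchard 1999 (Thm 3: hypothesis H2 ⇒ curve
dimension `> 1` with capacity lower bounds) fed by the mixing of currents (ADC 2021 §6, tree
`RandomCurrentsMixing*`) and the two-sided two-point control at scale `1/δ` that the limit hypotheses
provide (`PointwiseScalingLimitScale`, `criticalTwoPoint_bounds`, `dcp_isingEta_le_half`). Why it might
fail: only if backbones are `(1+η)`-thin for some ranking — then, through the exact necessary condition
`P[x↔z|δ] ≤ E Ñ_δ`, the crux itself is in doubt. Size L–XL (open). Uses `d = 3`. -/
theorem stub_partnerBackboneRough : PartnerBackboneRough := by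
  sorry

/-- **Stub 4 — (B) shadow + second moment: THE HEART** (see `BackboneShadowBound`). Plausibly true /
the bet: the backbone cut is porous (only the bonds examined from visited sites are deleted) and
codimension 2, so the shadow factor `⟨σ_xσ_u⟩_{H_δ}/⟨σ_xσ_u⟩` decays no faster than the roughness
affords (`D_bb ≥ Δ_σ + Δ̂`), and the contacts are not too bursty (`E N² ≲ (E N)²`, sharp cut–cut
decay along `γ`); free-wall sanity check of the card: `a = 2 - 0.518 - 1.275 = 0.207 > 0`. Why it might
fail: the card's own interpolation puts the sharp criterion at `2Δ̂(1.73) ≈ 1.86 > 1.73` (ratio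
`≍ L^{-0.13}`), i.e. marginal-to-failing — the Monte-Carlo shadow exponent (card falsifier (2)) should
be run before prover time; the pinched configuration / per-annulus amplification of the card is the
intended `X` and the fallback reshaping (triage r1-1/r1-2). Size XL (open; defect-exponent content with
no theorem in print). Uses `d = 3` (false on `ℤ⁵`). -/
theorem stub_backboneShadowBound : BackboneShadowBound := by
  sorry

/-! ### The skeleton theorems (conclude the crux BY NAME; no hypotheses; `sorry` only via the stubs) -/

/-- **`IsingEuclidUpgradeR4NonGaussian_of`** — the registered skeleton (A12 shape): the crux decl of the
item (`Theses.IsingEuclidUpgrade.IsingEuclidUpgradeR4NonGaussian`, the default of `ledger skeleton check`)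
with NO hypotheses, from the four declared `stub_*` through the sorry-free composition
`hasNontrivialU4_of_stubs`; its axiom closure is `{propext, Classical.choice, Quot.sound} ∪ {sorryAx via
the stubs}` until the stubs are proved. -/
theorem IsingEuclidUpgradeR4NonGaussian_of :
    Summit.CriticalPhenomena.Ising3DConformalLimit.Theses.IsingEuclidUpgrade.IsingEuclidUpgradeR4NonGaussian :=
  hasNontrivialU4_of_stubs stub_backboneCutDecomposition stub_cutContactSecondMoment
    stub_partnerBackboneRough stub_backboneShadowBound

/-- The same skeleton concluding the HyperoctahedralRP copy of the crux (the payload's primary route;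
same Prop, `Iff.rfl`). -/
theorem IsingEuclidUpgradeR4NonGaussian_of_hyperoctahedralRP :
    Summit.CriticalPhenomena.Ising3DConformalLimit.Theses.HyperoctahedralRP.IsingEuclidUpgradeR4NonGaussian :=
  hasNontrivialU4_of_stubs stub_backboneCutDecomposition stub_cutContactSecondMoment
    stub_partnerBackboneRough stub_backboneShadowBound

end Summit.CriticalPhenomena.Ising3DConformalLimit.Cruxes.IsingEuclidUpgradeR4NonGaussian.PartnerBackboneCut
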